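import Summits.QuantumFields.BalabanUV.Beta.D1BFx.SliceTransferModel

/-!
# `BalabanUV.Beta.D1BFx.SliceTransferGhostJets` — road «BF-x» for binder row D1, leaf K-R1 AT MODEL LEVEL, supply module for part 4:
# (S1) BASIS-FREE COMPRESSION INVARIANCE of the bordered functional, `det kkt (H + QᵀB + CQ) Q = det kkt H Q`;
# (S2) THE JETS OF THE INVERSE LEG AND OF THE COARSE GRAM `Q·X⁻¹·Qᵀ` as `HasDerivAt` suppliers

HONEST DEPENDENCY (page 1, mandatory): continuum YM on T⁴ ⇐ BetaPertH ∧ nine spine estimates (0/9 proved); BetaPertH ⇐ (D1) ∧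
(D4) ∧ CAP+tail; G-an2-4 gates asym, D1 and NE2/3/4.  HONEST FRAMING (cell contract, verbatim): «discharging `BetaPertH` makes
Bałaban's UV stability UNCONDITIONAL — a real constructive-QFT result; it is NOT the continuum limit and NOT the Clay problem.»
THIS MODULE DISCHARGES NOTHING of the wall: [folklore] finite-dimensional linear algebra and calculus over parts 1–2 of the road owner's
K-R1 model chain (`LogDetSecondVariation` p217126, `SliceTransferModel` p217295) and the tree's `Beta.Composition` §1 (`kkt`).  No `def`,
no `Prop` mirror, no cited fact, 0 sorry; 0 wall binders; NOT K-R1 at kernel level, NOT D1, NOT BetaPertH, NOT continuum, NOT Clay.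

ABSOLUTE RULE (cell charter, verbatim): «No internally-minted statement may enter as a cited fact. Every hypothesis is either
kernel-proved in this package or a verbatim quotation of a PUBLISHED theorem with page reference. The manuscript(s) under audit are NOT
citable for their own disputed steps — they are the thing under adjudication; programme-internal (2001/route/tribunal) claims are never
citable.»

WHY (road owner's `HOME/b2b-balaban-beta-d1-p2/K-R1-SPEC.md` v1.1 §2–§3, item (M4); the owner's part 4 `D1BFx/SliceTransferGhost` is the
(M4) of record: `secondVar_kkt_congr_of_compression` — the bordered functional `secondVar (kkt X Q)` sees `X` only through `ZᵀXZ` for a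
basis `Z` of `ker Q` — and `secondVar_kkt_mul_self` — `secondVar (kkt (MM) Q) = 2·secondVar M + secondVar (Q (MM)⁻¹ Qᵀ)` with the jets of
`X = MM` and `S = Q X⁻¹ Qᵀ` taken as ABSTRACT `C²` data).  This module supplies the two things a kernel-level consumer of part 4 still has to
produce by hand:
* (S1, §1–§2) a BASIS-FREE form of the compression invariance.  A constraint-directed perturbation of the form is a pair of unimodular
  block-triangular operations on the bordered matrix, `kkt (H + Qᵀ·B + C·Q) Q = [[1, C],[0, 1]] · kkt H Q · [[1, 0],[B, 1]]`, so
  `det kkt (H + QᵀB + CQ) Q = det kkt H Q` over any field with NO kernel basis, NO `det(QQᵀ) ≠ 0`, `B`, `C` arbitrary; in particular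
  `det kkt ((Δ + Qᵀ(aQ))·(Δ + Qᵀ(aQ))) Q = det kkt (Δ·Δ) Q` (the road's «`Δ_U²` ↔ `(Δ_U + Q′*aQ′)²`» swap: `M·M − Δ·Δ = Qᵀ(aQΔ + aQQᵀ(aQ)) +
  (ΔQᵀa)Q`).  Along `C²` curves (part 1's `secondVar_eq_of_logAbsDet_eq` with constant `0`): two form curves whose bordered determinants
  agree near `0` have the same bordered one-loop functional whatever their jets (`secondVar_kkt_congr_of_det`), hence so do `X` and
  `X + QᵀB + CQ` for ANY matrix-valued functions `B`, `C` of the parameter (`secondVar_kkt_congr_of_border`) and `Δ·Δ` and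
  `(Δ + Qᵀ(aQ))·(Δ + Qᵀ(aQ))` for any function `a` (`secondVar_kkt_congr_shift_sq`).
* (S2, §3) the JETS that part 4's `secondVar_kkt_mul_self` takes as hypotheses (`hS`, `hS₁` for `S = Q X⁻¹ Qᵀ`; the jets of `X = MM` are part 2's
  `hasDerivAt_matMul`): the Pi-form derivative of the inverse `(A⁻¹)′ = −A⁻¹A₁A⁻¹` at a point and near it (from part 1's entrywise
  `hasDerivAt_inv_entry`), the SECOND jet of the inverse, `(X·Yᵀ)′`, the sandwich `(Q·R·Qᵀ)′`, and the first / second jets of the coarse Gram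
  `u ↦ Q(u)·X(u)⁻¹·Q(u)ᵀ` written exactly as the product rule delivers them (`hasDerivAt_coarseGram`, `…_eventually`, `hasDerivAt_coarseGram₁`).
Nothing of Bałaban's operators is used; `Δ`, `Q`, `a`, the leg `X⁻¹` are letters (CONTEXT: covariant Laplacian, block averaging, coupling,
scalar tower).  NOT HERE: the (M4) END itself (owner's part 4), (M3), (K1) ℤ⁴ transcription, (K2).
-/

noncomputable section
namespace Summit.QuantumFields.BalabanUV.Beta.D1BFx.SliceTransferGhostJets

open Matrix Filter Finset
open scoped Topology
open Literature.MathematicalPhysics.QuantumFieldTheory.Balaban1983to89.Beta.Composition (kkt)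
open Literature.Analysis.Calculus (eventually_det_ne_zero)
open Summit.QuantumFields.BalabanUV.Beta.D1BFx.LogDetSecondVariation (secondVar secondVar_eq_of_logAbsDet_eq hasDerivAt_inv_entry)
open Summit.QuantumFields.BalabanUV.Beta.D1BFx.SliceTransferModel (hasDerivAt_matMul hasDerivAt_transpose hasDerivAt_kkt)

/-! ## §1 Basis-free compression invariance of the bordered determinant (any field) -/

section Algebra
variable {𝕜 : Type*} [Field 𝕜] {ν μ : Type*} [Fintype ν] [Fintype μ] [DecidableEq ν] [DecidableEq μ]

/-- [folklore] **BLINDNESS FACTORISATION**: a constraint-directed perturbation `Qᵀ·B + C·Q` of the form is produced by unimodular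
block-triangular row/column operations on the bordered matrix: `kkt (H + QᵀB + CQ) Q = [[1, C],[0, 1]] · kkt H Q · [[1, 0],[B, 1]]`. -/
theorem kkt_add_border (H : Matrix ν ν 𝕜) (Q : Matrix μ ν 𝕜) (B : Matrix μ ν 𝕜) (C : Matrix ν μ 𝕜) :
    kkt (H + Qᵀ * B + C * Q) Q = fromBlocks 1 C 0 1 * kkt H Q * fromBlocks 1 0 B 1 := by
  simp only [kkt, fromBlocks_multiply, Matrix.one_mul, Matrix.mul_one, Matrix.zero_mul, Matrix.mul_zero, add_zero, zero_add]
  congr 1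
  abel

/-- [folklore] **BASIS-FREE COMPRESSION INVARIANCE OF THE BORDERED DETERMINANT**: `det kkt (H + Qᵀ·B + C·Q) Q = det kkt H Q` — the
bordered determinant sees the form only on `ker Q` (no kernel basis, no Gram nondegeneracy, `B`, `C` arbitrary). -/
theorem det_kkt_add_border (H : Matrix ν ν 𝕜) (Q : Matrix μ ν 𝕜) (B : Matrix μ ν 𝕜) (C : Matrix ν μ 𝕜) :
    (kkt (H + Qᵀ * B + C * Q) Q).det = (kkt H Q).det := by
  rw [kkt_add_border, det_mul, det_mul, det_fromBlocks_zero₂₁, det_fromBlocks_zero₁₂, det_one, det_one]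
  ring

/-- [folklore] **THE SQUARE OF THE SHIFTED FORM IS BORDERED-EQUIVALENT TO THE SQUARE**: for `M = Δ + Qᵀ·(a·Q)`,
`det kkt (M·M) Q = det kkt (Δ·Δ) Q` (`M·M − Δ·Δ = Qᵀ·(aQΔ + aQQᵀ(aQ)) + (ΔQᵀa)·Q`). -/
theorem det_kkt_shift_mul_shift (Δ : Matrix ν ν 𝕜) (Q : Matrix μ ν 𝕜) (a : Matrix μ μ 𝕜) :
    (kkt ((Δ + Qᵀ * (a * Q)) * (Δ + Qᵀ * (a * Q))) Q).det = (kkt (Δ * Δ) Q).det := by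
  have h : (Δ + Qᵀ * (a * Q)) * (Δ + Qᵀ * (a * Q))
      = Δ * Δ + Qᵀ * (a * Q * Δ + a * Q * Qᵀ * (a * Q)) + Δ * Qᵀ * a * Q := by
    simp only [Matrix.add_mul, Matrix.mul_add, Matrix.mul_assoc]
    abel
  rw [h, det_kkt_add_border]

end Algebra

/-! ## §2 Curve form: form curves with equal bordered determinants have the same bordered one-loop functional -/

section Congr
variable {ν μ : Type*} [Fintype ν] [Fintype μ] [DecidableEq ν] [DecidableEq μ]

/-- [folklore] **CONGRUENCE OF THE BORDERED FUNCTIONAL FROM EQUAL BORDERED DETERMINANTS**: two `C²` form curves `X`, `X′` (first jets near `0`,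
second jets at `0`, arbitrary) bordered by the same `C²` constraint curve `Q`, with `det kkt X Q = det kkt X′ Q` near `0` and
`det kkt X Q ≠ 0` at `0`, have the same `secondVar (kkt · Q)` at `0` (part 1's uniqueness `secondVar_eq_of_logAbsDet_eq`, constant `0`). -/
theorem secondVar_kkt_congr_of_det
    {X X₁ X' X'₁ : ℝ → ν → ν → ℝ} {X₂ X'₂ : Matrix ν ν ℝ} {Q Q₁ : ℝ → μ → ν → ℝ} {Q₂ : Matrix μ ν ℝ}
    (hX : ∀ᶠ u in 𝓝 (0 : ℝ), HasDerivAt X (X₁ u) u) (hX₁ : HasDerivAt X₁ (Matrix.of.symm X₂) 0)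
    (hX' : ∀ᶠ u in 𝓝 (0 : ℝ), HasDerivAt X' (X'₁ u) u) (hX'₁ : HasDerivAt X'₁ (Matrix.of.symm X'₂) 0)
    (hQ : ∀ᶠ u in 𝓝 (0 : ℝ), HasDerivAt Q (Q₁ u) u) (hQ₁ : HasDerivAt Q₁ (Matrix.of.symm Q₂) 0)
    (hdet : ∀ᶠ u in 𝓝 (0 : ℝ), (kkt (Matrix.of (X u)) (Matrix.of (Q u))).det = (kkt (Matrix.of (X' u)) (Matrix.of (Q u))).det)
    (hd : (kkt (Matrix.of (X 0)) (Matrix.of (Q 0))).det ≠ 0) :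
    secondVar (kkt (Matrix.of (X 0)) (Matrix.of (Q 0))) (kkt (Matrix.of (X₁ 0)) (Matrix.of (Q₁ 0))) (kkt X₂ Q₂)
      = secondVar (kkt (Matrix.of (X' 0)) (Matrix.of (Q 0))) (kkt (Matrix.of (X'₁ 0)) (Matrix.of (Q₁ 0))) (kkt X'₂ Q₂) := by
  have hXe : ∀ᶠ u in 𝓝 (0 : ℝ), HasDerivAt X (Matrix.of.symm (Matrix.of (X₁ u))) u := hX
  have hX'e : ∀ᶠ u in 𝓝 (0 : ℝ), HasDerivAt X' (Matrix.of.symm (Matrix.of (X'₁ u))) u := hX'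
  have hQe : ∀ᶠ u in 𝓝 (0 : ℝ), HasDerivAt Q (Matrix.of.symm (Matrix.of (Q₁ u))) u := hQ
  -- the two bordered curves and their jets (part 2's `hasDerivAt_kkt`)
  have hBd : ∀ᶠ u in 𝓝 (0 : ℝ), HasDerivAt (fun u => Matrix.of.symm (kkt (Matrix.of (X u)) (Matrix.of (Q u))))
      ((fun u => Matrix.of.symm (kkt (Matrix.of (X₁ u)) (Matrix.of (Q₁ u)))) u) u := by
    filter_upwards [hXe, hQe] with u huX huQ
    exact hasDerivAt_kkt huX huQ
  have hB₁d : HasDerivAt (fun u => Matrix.of.symm (kkt (Matrix.of (X₁ u)) (Matrix.of (Q₁ u)))) (Matrix.of.symm (kkt X₂ Q₂)) 0 :=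
    hasDerivAt_kkt hX₁ hQ₁
  have hB'd : ∀ᶠ u in 𝓝 (0 : ℝ), HasDerivAt (fun u => Matrix.of.symm (kkt (Matrix.of (X' u)) (Matrix.of (Q u))))
      ((fun u => Matrix.of.symm (kkt (Matrix.of (X'₁ u)) (Matrix.of (Q₁ u)))) u) u := by
    filter_upwards [hX'e, hQe] with u huX huQ
    exact hasDerivAt_kkt huX huQ
  have hB'₁d : HasDerivAt (fun u => Matrix.of.symm (kkt (Matrix.of (X'₁ u)) (Matrix.of (Q₁ u)))) (Matrix.of.symm (kkt X'₂ Q₂)) 0 :=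
    hasDerivAt_kkt hX'₁ hQ₁
  have hd' : (Matrix.of (Matrix.of.symm (kkt (Matrix.of (X' 0)) (Matrix.of (Q 0))))).det ≠ 0 := by
    show (kkt (Matrix.of (X' 0)) (Matrix.of (Q 0))).det ≠ 0
    rw [← hdet.self_of_nhds]
    exact hd
  have heq : ∀ᶠ u in 𝓝 (0 : ℝ), Real.log |(Matrix.of (Matrix.of.symm (kkt (Matrix.of (X u)) (Matrix.of (Q u))))).det|
      = Real.log |(Matrix.of (Matrix.of.symm (kkt (Matrix.of (X' u)) (Matrix.of (Q u))))).det| + 0 := by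
    filter_upwards [hdet] with u hu
    show Real.log |(kkt (Matrix.of (X u)) (Matrix.of (Q u))).det| = Real.log |(kkt (Matrix.of (X' u)) (Matrix.of (Q u))).det| + 0
    rw [hu, add_zero]
  have h := secondVar_eq_of_logAbsDet_eq hBd hB₁d hd hB'd hB'₁d hd' heq
  exact h

/-- [folklore] **BASIS-FREE COMPRESSION INVARIANCE OF THE BORDERED FUNCTIONAL**: if `X′(u) = X(u) + Q(u)ᵀ·B(u) + C(u)·Q(u)` near `0` for
ANY matrix-valued functions `B`, `C` of the parameter (no regularity asked), then `secondVar (kkt X Q) = secondVar (kkt X′ Q)` at `0`, whatever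
the jets of `X`, `X′` — the hypothesis-light twin of part 4's `secondVar_kkt_congr_of_compression` (no kernel basis, no `det(QQᵀ) ≠ 0`). -/
theorem secondVar_kkt_congr_of_border
    {X X₁ X' X'₁ : ℝ → ν → ν → ℝ} {X₂ X'₂ : Matrix ν ν ℝ} {Q Q₁ : ℝ → μ → ν → ℝ} {Q₂ : Matrix μ ν ℝ}
    {B : ℝ → Matrix μ ν ℝ} {C : ℝ → Matrix ν μ ℝ}
    (hX : ∀ᶠ u in 𝓝 (0 : ℝ), HasDerivAt X (X₁ u) u) (hX₁ : HasDerivAt X₁ (Matrix.of.symm X₂) 0)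
    (hX' : ∀ᶠ u in 𝓝 (0 : ℝ), HasDerivAt X' (X'₁ u) u) (hX'₁ : HasDerivAt X'₁ (Matrix.of.symm X'₂) 0)
    (hQ : ∀ᶠ u in 𝓝 (0 : ℝ), HasDerivAt Q (Q₁ u) u) (hQ₁ : HasDerivAt Q₁ (Matrix.of.symm Q₂) 0)
    (hbord : ∀ᶠ u in 𝓝 (0 : ℝ), Matrix.of (X' u) = Matrix.of (X u) + (Matrix.of (Q u))ᵀ * B u + C u * Matrix.of (Q u))
    (hd : (kkt (Matrix.of (X 0)) (Matrix.of (Q 0))).det ≠ 0) :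
    secondVar (kkt (Matrix.of (X 0)) (Matrix.of (Q 0))) (kkt (Matrix.of (X₁ 0)) (Matrix.of (Q₁ 0))) (kkt X₂ Q₂)
      = secondVar (kkt (Matrix.of (X' 0)) (Matrix.of (Q 0))) (kkt (Matrix.of (X'₁ 0)) (Matrix.of (Q₁ 0))) (kkt X'₂ Q₂) := by
  refine secondVar_kkt_congr_of_det hX hX₁ hX' hX'₁ hQ hQ₁ ?_ hd
  filter_upwards [hbord] with u hu
  rw [hu, det_kkt_add_border]

/-- [folklore] **THE BILAPLACIAN AND THE SQUARED SHIFTED FORM HAVE THE SAME BORDERED FUNCTIONAL**: if `X(u) = Δ(u)·Δ(u)` and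
`X′(u) = (Δ(u) + Q(u)ᵀ(a(u)Q(u)))·(Δ(u) + Q(u)ᵀ(a(u)Q(u)))` near `0` (any function `a`; jets of `X`, `X′` arbitrary `C²` data), then
`secondVar (kkt X Q) = secondVar (kkt X′ Q)` at `0` — the road's «`h[kkt Δ_U² Q′] = h[kkt (Δ_U + Q′*aQ′)² Q′]`» with no kernel basis. -/
theorem secondVar_kkt_congr_shift_sq
    {X X₁ X' X'₁ Δ : ℝ → ν → ν → ℝ} {X₂ X'₂ : Matrix ν ν ℝ} {Q Q₁ : ℝ → μ → ν → ℝ} {Q₂ : Matrix μ ν ℝ} {a : ℝ → Matrix μ μ ℝ}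
    (hX : ∀ᶠ u in 𝓝 (0 : ℝ), HasDerivAt X (X₁ u) u) (hX₁ : HasDerivAt X₁ (Matrix.of.symm X₂) 0)
    (hX' : ∀ᶠ u in 𝓝 (0 : ℝ), HasDerivAt X' (X'₁ u) u) (hX'₁ : HasDerivAt X'₁ (Matrix.of.symm X'₂) 0)
    (hQ : ∀ᶠ u in 𝓝 (0 : ℝ), HasDerivAt Q (Q₁ u) u) (hQ₁ : HasDerivAt Q₁ (Matrix.of.symm Q₂) 0)
    (hXΔ : ∀ᶠ u in 𝓝 (0 : ℝ), Matrix.of (X u) = Matrix.of (Δ u) * Matrix.of (Δ u))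
    (hX'Δ : ∀ᶠ u in 𝓝 (0 : ℝ), Matrix.of (X' u)
      = (Matrix.of (Δ u) + (Matrix.of (Q u))ᵀ * (a u * Matrix.of (Q u))) * (Matrix.of (Δ u) + (Matrix.of (Q u))ᵀ * (a u * Matrix.of (Q u))))
    (hd : (kkt (Matrix.of (X 0)) (Matrix.of (Q 0))).det ≠ 0) :
    secondVar (kkt (Matrix.of (X 0)) (Matrix.of (Q 0))) (kkt (Matrix.of (X₁ 0)) (Matrix.of (Q₁ 0))) (kkt X₂ Q₂)
      = secondVar (kkt (Matrix.of (X' 0)) (Matrix.of (Q 0))) (kkt (Matrix.of (X'₁ 0)) (Matrix.of (Q₁ 0))) (kkt X'₂ Q₂) := by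
  refine secondVar_kkt_congr_of_det hX hX₁ hX' hX'₁ hQ hQ₁ ?_ hd
  filter_upwards [hXΔ, hX'Δ] with u hu hu'
  rw [hu, hu', det_kkt_shift_mul_shift]

end Congr

/-! ## §3 Jet suppliers: the inverse leg, `(X·Yᵀ)′`, the sandwich, and the coarse Gram `Q·X⁻¹·Qᵀ` -/

section Jets
variable {ι κ θ : Type*} [Fintype ι] [Fintype κ] [Fintype θ] [DecidableEq ι]

/-- [folklore] **PI-FORM JET OF THE INVERSE** (part 1's `hasDerivAt_inv_entry` assembled): if `A` has derivative `A₁` at `t` and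
`det A(t) ≠ 0`, the inverse curve `u ↦ A(u)⁻¹` has derivative `−A(t)⁻¹·A₁·A(t)⁻¹` at `t`. -/
theorem hasDerivAt_inv {A : ℝ → ι → ι → ℝ} {A₁ : Matrix ι ι ℝ} {t : ℝ}
    (hA : HasDerivAt A (Matrix.of.symm A₁) t) (hdet : (Matrix.of (A t)).det ≠ 0) :
    HasDerivAt (fun u => Matrix.of.symm (Matrix.of (A u))⁻¹)
      (Matrix.of.symm (-((Matrix.of (A t))⁻¹ * A₁ * (Matrix.of (A t))⁻¹))) t := by
  refine hasDerivAt_pi.2 fun k => hasDerivAt_pi.2 fun l => ?_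
  exact hasDerivAt_inv_entry hA hdet k l

/-- [folklore] The inverse curve NEAR a nondegenerate point: if `A` has derivative `A₁(u)` at every `u` near `t` and `det A(t) ≠ 0`, then
near `t` the curve `u ↦ A(u)⁻¹` has derivative `−A(u)⁻¹·A₁(u)·A(u)⁻¹` (nondegeneracy propagates by continuity of `det`). -/
theorem hasDerivAt_inv_eventually {A A₁ : ℝ → ι → ι → ℝ} {t : ℝ}
    (hA : ∀ᶠ u in 𝓝 t, HasDerivAt A (A₁ u) u) (hdet : (Matrix.of (A t)).det ≠ 0) :
    ∀ᶠ u in 𝓝 t, HasDerivAt (fun u => Matrix.of.symm (Matrix.of (A u))⁻¹)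
      (Matrix.of.symm (-((Matrix.of (A u))⁻¹ * Matrix.of (A₁ u) * (Matrix.of (A u))⁻¹))) u := by
  have hA' : ∀ᶠ u in 𝓝 t, HasDerivAt A (Matrix.of.symm (Matrix.of (A₁ u))) u := hA
  filter_upwards [hA', eventually_det_ne_zero hA.self_of_nhds.hasFDerivAt hdet] with u huA hud
  exact hasDerivAt_inv huA hud

/-- [folklore] **SECOND JET OF THE INVERSE**: the derivative at `t` of the first-jet curve `u ↦ −A(u)⁻¹·A₁(u)·A(u)⁻¹` of the inverse
(`A′(t) = A₁(t)`, `A₁′(t) = A₂`, `det A(t) ≠ 0`), written as the product rule delivers it: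
`−(((−A⁻¹A₁A⁻¹)·A₁ + A⁻¹·A₂)·A⁻¹ + (A⁻¹A₁)·(−A⁻¹A₁A⁻¹))` (`= 2·A⁻¹A₁A⁻¹A₁A⁻¹ − A⁻¹A₂A⁻¹`). -/
theorem hasDerivAt_inv_jet₁ {A A₁ : ℝ → ι → ι → ℝ} {A₂ : Matrix ι ι ℝ} {t : ℝ}
    (hA : HasDerivAt A (Matrix.of.symm (Matrix.of (A₁ t))) t) (hA₁ : HasDerivAt A₁ (Matrix.of.symm A₂) t)
    (hdet : (Matrix.of (A t)).det ≠ 0) :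
    HasDerivAt (fun u => Matrix.of.symm (-((Matrix.of (A u))⁻¹ * Matrix.of (A₁ u) * (Matrix.of (A u))⁻¹)))
      (Matrix.of.symm (-((-((Matrix.of (A t))⁻¹ * Matrix.of (A₁ t) * (Matrix.of (A t))⁻¹) * Matrix.of (A₁ t)
          + (Matrix.of (A t))⁻¹ * A₂) * (Matrix.of (A t))⁻¹
        + (Matrix.of (A t))⁻¹ * Matrix.of (A₁ t) * -((Matrix.of (A t))⁻¹ * Matrix.of (A₁ t) * (Matrix.of (A t))⁻¹)))) t := by
  have hG := hasDerivAt_inv hA hdet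
  have h1 := hasDerivAt_matMul (X := fun u => Matrix.of.symm (Matrix.of (A u))⁻¹) hG hA₁
  have h2 := hasDerivAt_matMul (X := fun u => Matrix.of.symm ((Matrix.of (A u))⁻¹ * Matrix.of (A₁ u)))
    (Y := fun u => Matrix.of.symm (Matrix.of (A u))⁻¹) h1 hG
  exact h2.neg

omit [Fintype ι] [DecidableEq ι] in
/-- [folklore] `(X·Yᵀ)′ = X′·Yᵀ + X·Y′ᵀ`. -/
theorem hasDerivAt_mul_transpose {X : ℝ → ι → θ → ℝ} {Y : ℝ → κ → θ → ℝ} {X' : Matrix ι θ ℝ} {Y' : Matrix κ θ ℝ} {t : ℝ}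
    (hX : HasDerivAt X (Matrix.of.symm X') t) (hY : HasDerivAt Y (Matrix.of.symm Y') t) :
    HasDerivAt (fun u => Matrix.of.symm (Matrix.of (X u) * (Matrix.of (Y u))ᵀ))
      (Matrix.of.symm (X' * (Matrix.of (Y t))ᵀ + Matrix.of (X t) * Y'ᵀ)) t :=
  hasDerivAt_matMul (Y := fun u => Matrix.of.symm (Matrix.of (Y u))ᵀ) hX (hasDerivAt_transpose hY)

omit [DecidableEq ι] in
/-- [folklore] **THE SANDWICH** `(Q·R·Qᵀ)′ = (Q′R + QR′)·Qᵀ + (QR)·Q′ᵀ`. -/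
theorem hasDerivAt_sandwich {Q : ℝ → κ → ι → ℝ} {R : ℝ → ι → ι → ℝ} {Q' : Matrix κ ι ℝ} {R' : Matrix ι ι ℝ} {t : ℝ}
    (hQ : HasDerivAt Q (Matrix.of.symm Q') t) (hR : HasDerivAt R (Matrix.of.symm R') t) :
    HasDerivAt (fun u => Matrix.of.symm (Matrix.of (Q u) * Matrix.of (R u) * (Matrix.of (Q u))ᵀ))
      (Matrix.of.symm ((Q' * Matrix.of (R t) + Matrix.of (Q t) * R') * (Matrix.of (Q t))ᵀ
        + Matrix.of (Q t) * Matrix.of (R t) * Q'ᵀ)) t :=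
  hasDerivAt_mul_transpose (X := fun u => Matrix.of.symm (Matrix.of (Q u) * Matrix.of (R u))) (hasDerivAt_matMul hQ hR) hQ

/-- [folklore] **FIRST JET OF THE COARSE GRAM** `S = Q·X⁻¹·Qᵀ` at a point where `det X ≠ 0`:
`S′ = (Q′X⁻¹ + Q·(−X⁻¹X′X⁻¹))·Qᵀ + (QX⁻¹)·Q′ᵀ`. -/
theorem hasDerivAt_coarseGram {Q : ℝ → κ → ι → ℝ} {X : ℝ → ι → ι → ℝ} {Q' : Matrix κ ι ℝ} {X' : Matrix ι ι ℝ} {t : ℝ}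
    (hQ : HasDerivAt Q (Matrix.of.symm Q') t) (hX : HasDerivAt X (Matrix.of.symm X') t) (hdet : (Matrix.of (X t)).det ≠ 0) :
    HasDerivAt (fun u => Matrix.of.symm (Matrix.of (Q u) * (Matrix.of (X u))⁻¹ * (Matrix.of (Q u))ᵀ))
      (Matrix.of.symm ((Q' * (Matrix.of (X t))⁻¹ + Matrix.of (Q t) * -((Matrix.of (X t))⁻¹ * X' * (Matrix.of (X t))⁻¹))
          * (Matrix.of (Q t))ᵀ
        + Matrix.of (Q t) * (Matrix.of (X t))⁻¹ * Q'ᵀ)) t :=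
  hasDerivAt_sandwich (R := fun u => Matrix.of.symm (Matrix.of (X u))⁻¹) hQ (hasDerivAt_inv hX hdet)

/-- [folklore] The coarse Gram NEAR a nondegenerate point: with `Q′(u) = Q₁(u)`, `X′(u) = X₁(u)` near `t` and `det X(t) ≠ 0`, near `t`
`u ↦ Q·X⁻¹·Qᵀ` has derivative `(Q₁X⁻¹ + Q·(−X⁻¹X₁X⁻¹))·Qᵀ + (QX⁻¹)·Q₁ᵀ` (evaluated at `u`) — the shape of part 4's hypothesis `hS`. -/
theorem hasDerivAt_coarseGram_eventually {Q Q₁ : ℝ → κ → ι → ℝ} {X X₁ : ℝ → ι → ι → ℝ} {t : ℝ}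
    (hQ : ∀ᶠ u in 𝓝 t, HasDerivAt Q (Q₁ u) u) (hX : ∀ᶠ u in 𝓝 t, HasDerivAt X (X₁ u) u) (hdet : (Matrix.of (X t)).det ≠ 0) :
    ∀ᶠ u in 𝓝 t, HasDerivAt (fun u => Matrix.of.symm (Matrix.of (Q u) * (Matrix.of (X u))⁻¹ * (Matrix.of (Q u))ᵀ))
      ((fun u => Matrix.of.symm ((Matrix.of (Q₁ u) * (Matrix.of (X u))⁻¹
          + Matrix.of (Q u) * -((Matrix.of (X u))⁻¹ * Matrix.of (X₁ u) * (Matrix.of (X u))⁻¹)) * (Matrix.of (Q u))ᵀ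
        + Matrix.of (Q u) * (Matrix.of (X u))⁻¹ * (Matrix.of (Q₁ u))ᵀ)) u) u := by
  have hQ' : ∀ᶠ u in 𝓝 t, HasDerivAt Q (Matrix.of.symm (Matrix.of (Q₁ u))) u := hQ
  have hX' : ∀ᶠ u in 𝓝 t, HasDerivAt X (Matrix.of.symm (Matrix.of (X₁ u))) u := hX
  filter_upwards [hQ', hX', eventually_det_ne_zero hX.self_of_nhds.hasFDerivAt hdet] with u huQ huX hud
  exact hasDerivAt_coarseGram huQ huX hud

/-- [folklore] **SECOND JET OF THE COARSE GRAM**: the derivative at `t` of the first-jet curve of `Q·X⁻¹·Qᵀ` (as in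
`hasDerivAt_coarseGram_eventually`), given `Q′(t) = Q₁(t)`, `Q₁′(t) = Q₂`, `X′(t) = X₁(t)`, `X₁′(t) = X₂`, `det X(t) ≠ 0`, written exactly as
the product rule delivers it — the shape of part 4's hypothesis `hS₁` (take its value as `S₂`). -/
theorem hasDerivAt_coarseGram₁ {Q Q₁ : ℝ → κ → ι → ℝ} {X X₁ : ℝ → ι → ι → ℝ} {Q₂ : Matrix κ ι ℝ} {X₂ : Matrix ι ι ℝ} {t : ℝ}
    (hQ : HasDerivAt Q (Matrix.of.symm (Matrix.of (Q₁ t))) t) (hQ₁ : HasDerivAt Q₁ (Matrix.of.symm Q₂) t)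
    (hX : HasDerivAt X (Matrix.of.symm (Matrix.of (X₁ t))) t) (hX₁ : HasDerivAt X₁ (Matrix.of.symm X₂) t)
    (hdet : (Matrix.of (X t)).det ≠ 0) :
    HasDerivAt
      (fun u => Matrix.of.symm ((Matrix.of (Q₁ u) * (Matrix.of (X u))⁻¹
          + Matrix.of (Q u) * -((Matrix.of (X u))⁻¹ * Matrix.of (X₁ u) * (Matrix.of (X u))⁻¹)) * (Matrix.of (Q u))ᵀ
        + Matrix.of (Q u) * (Matrix.of (X u))⁻¹ * (Matrix.of (Q₁ u))ᵀ))
      (Matrix.of.symm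
        ((Q₂ * (Matrix.of (X t))⁻¹ + Matrix.of (Q₁ t) * -((Matrix.of (X t))⁻¹ * Matrix.of (X₁ t) * (Matrix.of (X t))⁻¹)
            + (Matrix.of (Q₁ t) * -((Matrix.of (X t))⁻¹ * Matrix.of (X₁ t) * (Matrix.of (X t))⁻¹)
              + Matrix.of (Q t) * -((-((Matrix.of (X t))⁻¹ * Matrix.of (X₁ t) * (Matrix.of (X t))⁻¹) * Matrix.of (X₁ t)
                  + (Matrix.of (X t))⁻¹ * X₂) * (Matrix.of (X t))⁻¹
                + (Matrix.of (X t))⁻¹ * Matrix.of (X₁ t) * -((Matrix.of (X t))⁻¹ * Matrix.of (X₁ t) * (Matrix.of (X t))⁻¹))))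
            * (Matrix.of (Q t))ᵀ
          + (Matrix.of (Q₁ t) * (Matrix.of (X t))⁻¹
              + Matrix.of (Q t) * -((Matrix.of (X t))⁻¹ * Matrix.of (X₁ t) * (Matrix.of (X t))⁻¹)) * (Matrix.of (Q₁ t))ᵀ
          + ((Matrix.of (Q₁ t) * (Matrix.of (X t))⁻¹ + Matrix.of (Q t) * -((Matrix.of (X t))⁻¹ * Matrix.of (X₁ t) * (Matrix.of (X t))⁻¹))
              * (Matrix.of (Q₁ t))ᵀ
            + Matrix.of (Q t) * (Matrix.of (X t))⁻¹ * Q₂ᵀ))) t := by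
  have hG := hasDerivAt_inv hX hdet
  have hG₁ := hasDerivAt_inv_jet₁ hX hX₁ hdet
  -- first summand: `(Q₁X⁻¹ + Q·G₁) · Qᵀ`
  have hA : HasDerivAt (fun u => Matrix.of.symm (Matrix.of (Q₁ u) * (Matrix.of (X u))⁻¹
      + Matrix.of (Q u) * -((Matrix.of (X u))⁻¹ * Matrix.of (X₁ u) * (Matrix.of (X u))⁻¹)))
      (Matrix.of.symm (Q₂ * (Matrix.of (X t))⁻¹ + Matrix.of (Q₁ t) * -((Matrix.of (X t))⁻¹ * Matrix.of (X₁ t) * (Matrix.of (X t))⁻¹)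
        + (Matrix.of (Q₁ t) * -((Matrix.of (X t))⁻¹ * Matrix.of (X₁ t) * (Matrix.of (X t))⁻¹)
          + Matrix.of (Q t) * -((-((Matrix.of (X t))⁻¹ * Matrix.of (X₁ t) * (Matrix.of (X t))⁻¹) * Matrix.of (X₁ t)
              + (Matrix.of (X t))⁻¹ * X₂) * (Matrix.of (X t))⁻¹
            + (Matrix.of (X t))⁻¹ * Matrix.of (X₁ t) * -((Matrix.of (X t))⁻¹ * Matrix.of (X₁ t) * (Matrix.of (X t))⁻¹))))) t :=
    (hasDerivAt_matMul (Y := fun u => Matrix.of.symm (Matrix.of (X u))⁻¹) hQ₁ hG).add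
      (hasDerivAt_matMul (Y := fun u => Matrix.of.symm (-((Matrix.of (X u))⁻¹ * Matrix.of (X₁ u) * (Matrix.of (X u))⁻¹))) hQ hG₁)
  have h1 := hasDerivAt_mul_transpose (X := fun u => Matrix.of.symm (Matrix.of (Q₁ u) * (Matrix.of (X u))⁻¹
      + Matrix.of (Q u) * -((Matrix.of (X u))⁻¹ * Matrix.of (X₁ u) * (Matrix.of (X u))⁻¹))) hA hQ
  -- second summand: `(Q·X⁻¹) · Q₁ᵀ`
  have h2 := hasDerivAt_mul_transpose (X := fun u => Matrix.of.symm (Matrix.of (Q u) * (Matrix.of (X u))⁻¹))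
    (hasDerivAt_matMul (Y := fun u => Matrix.of.symm (Matrix.of (X u))⁻¹) hQ hG) hQ₁
  exact h1.add h2

end Jets

end Summit.QuantumFields.BalabanUV.Beta.D1BFx.SliceTransferGhostJets
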